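import Summits.Ventures.PercRepro.Night2OneFatTargets

/-!
# PercRepro — the good-target rule with the DISTANCE-2 fallback (night-2, gen 29)

`dshGT` (Night2LocalRuleGood) falls back to the missed-point targets when a lossy covering set `Q` has no good point.
That fallback fails (proofs/NIGHT-2-g29.md §4′(a): a doubly-covered configuration, column ratio `1.052`).  The repair of
record «good2»: when `Q` has no good point, the loss of `(B, z)` is split equally over the **distance-2 targets**
`Q ∪ {x, x′}`, `x ≠ x′` two points of `G ∖ Q` missed by the closures of two DIFFERENT thin faces of `Q`; when there is
none either, the missed-point targets.  Without a good point every point outside `Q` lies in the closures of at least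
two of the three thin faces of a lossy big `Q` (cell `(2, 1)`), so `x` and `x′` both lie in the closure of the third face,
whose coloop stays a coloop of the target: a distance-2 fallback target has a coloop off `K` — coloop-free targets receive
nothing from the fallback (`exists_mem_coloops_of_d2Target`).

* `d2Pts`, `d2Targets`, `dshGT2`; `mem_d2Pts`, `mem_d2Targets`, `d2Targets_subset_shadowAt`;
* `dshGT2_nonneg`, `dshGT2_supp`, `dshGT2_row`, **`localShadowHall_of_gt2`**;
* `mem_coloops_insert_of_mem_clF'` (the coloop transfer with `K ⊆ Q ∖ w` and `rk (Q ∖ w) = 5` in place of thin membership),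
  **`exists_mem_coloops_of_d2Target`**.
-/

namespace PercRepro.Shadow

open Finset PerFlat ThmH

variable {α : Type*} [DecidableEq α] {M : Matroid α} [M.Finite]

section GoodTwo

variable (M) (q : ℕ) (G : Finset α)

open scoped Classical in
/-- The point pairs of the distance-2 fallback of `Q`: `(x, x′)`, `x ≠ x′` in `G ∖ Q`, `x ∉ cl F`, `x′ ∉ cl F′` for two
different thin faces `F ≠ F′` of `Q`. -/
noncomputable def d2Pts (Q : Finset α) : Finset (α × α) :=
  ((G \ Q) ×ˢ (G \ Q)).filter (fun p => p.1 ≠ p.2 ∧ ∃ F ∈ thinFacesOf M q G Q, ∃ F' ∈ thinFacesOf M q G Q,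
    F ≠ F' ∧ p.1 ∉ clF M F ∧ p.2 ∉ clF M F')

/-- The distance-2 fallback targets of `Q`. -/
noncomputable def d2Targets (Q : Finset α) : Finset (Finset α) :=
  (d2Pts M q G Q).image (fun p => insert p.1 (insert p.2 Q))

/-- The good-target shares with the distance-2 fallback. -/
noncomputable def dshGT2 (B : Finset α) (z : α) (S : Finset α) : ℚ :=
  if (gtPts M q G (insert z B)).Nonempty then
    (if S ∈ gtTargets M q G B z then loss M q G B z / ((gtTargets M q G B z).card : ℚ) else 0)
  else if (d2Targets M q G (insert z B)).Nonempty then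
    (if S ∈ d2Targets M q G (insert z B) then loss M q G B z / ((d2Targets M q G (insert z B)).card : ℚ) else 0)
  else dshMissed M q G B z S

end GoodTwo

section GoodTwoLemmas

variable {q : ℕ} {G : Finset α}

open scoped Classical in
/-- Membership in `d2Pts`. -/
theorem mem_d2Pts {Q : Finset α} {p : α × α} :
    p ∈ d2Pts M q G Q ↔ (p.1 ∈ G \ Q ∧ p.2 ∈ G \ Q) ∧ p.1 ≠ p.2 ∧ ∃ F ∈ thinFacesOf M q G Q,
      ∃ F' ∈ thinFacesOf M q G Q, F ≠ F' ∧ p.1 ∉ clF M F ∧ p.2 ∉ clF M F' := by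
  unfold d2Pts
  rw [Finset.mem_filter, Finset.mem_product]

/-- Membership in `d2Targets`. -/
theorem mem_d2Targets {Q S : Finset α} :
    S ∈ d2Targets M q G Q ↔ ∃ p ∈ d2Pts M q G Q, insert p.1 (insert p.2 Q) = S := by
  unfold d2Targets
  rw [Finset.mem_image]

/-- The distance-2 targets of a pair of a member inside `G` are shadow sets. -/
theorem d2Targets_subset_shadowAt (hG : G ∈ flatsQ M (q + 1)) {B : Finset α}
    (hB : B ∈ membersIn M (Uq M (q + 2) q) G) {z : α} (hz : z ∈ G \ clF M B) :
    d2Targets M q G (insert z B) ⊆ shadowAt M (q + 2) q (Uq M (q + 2) q) G := by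
  intro S hS
  obtain ⟨p, hp, rfl⟩ := mem_d2Targets.1 hS
  obtain ⟨⟨h1, h2⟩, -, -⟩ := mem_d2Pts.1 hp
  have hBG : clF M B ⊆ G := (mem_membersIn.1 hB).2
  have hBU : B ∈ Uq M (q + 2) q := (mem_membersIn.1 hB).1
  have hBsub : B ⊆ G := (subset_clF hBU).trans hBG
  exact superset_mem_shadowAt hG hB hz ((Finset.subset_insert _ _).trans (Finset.subset_insert _ _))
    (Finset.insert_subset (Finset.mem_sdiff.1 h1).1 (Finset.insert_subset (Finset.mem_sdiff.1 h2).1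
      (Finset.insert_subset (Finset.mem_sdiff.1 hz).1 hBsub)))

/-- The shares are nonnegative. -/
theorem dshGT2_nonneg (hG : G ∈ flatsQ M (q + 1)) (hd : (gr M \ G).card ≤ q) (B : Finset α) (z : α)
    (S : Finset α) : 0 ≤ dshGT2 M q G B z S := by
  unfold dshGT2
  split_ifs
  · exact div_nonneg (loss_nonneg' hG hd B z) (by positivity)
  · exact le_refl _
  · exact div_nonneg (loss_nonneg' hG hd B z) (by positivity)
  · exact le_refl _
  · exact dshMissed_nonneg hG hd B z S

/-- The shares are supported on the supersets of `B ∪ {z}`. -/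
theorem dshGT2_supp (B : Finset α) (z : α) (S : Finset α) (h : dshGT2 M q G B z S ≠ 0) :
    insert z B ⊆ S := by
  unfold dshGT2 at h
  split_ifs at h with h1 h2 h3 h4
  · obtain ⟨x, -, rfl⟩ := mem_goodTargets.1 h2
    exact Finset.subset_insert x _
  · exact absurd rfl h
  · obtain ⟨p, -, rfl⟩ := mem_d2Targets.1 h4
    exact (Finset.subset_insert _ _).trans (Finset.subset_insert _ _)
  · exact absurd rfl h
  · exact dshMissed_supp B z S h

open scoped Classical in
/-- The shares of a thin pair sum to its loss. -/
theorem dshGT2_row (hG : G ∈ flatsQ M (q + 1)) (hd : (gr M \ G).card ≤ q) {B : Finset α}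
    (hB : B ∈ thinMembers M q G) {z : α} (hz : z ∈ G \ clF M B) :
    ∑ S ∈ shadowAt M (q + 2) q (Uq M (q + 2) q) G, dshGT2 M q G B z S = loss M q G B z := by
  unfold dshGT2
  by_cases hne : (gtPts M q G (insert z B)).Nonempty
  · simp only [if_pos hne]
    rw [← Finset.sum_filter, Finset.filter_mem_eq_inter,
      Finset.inter_eq_right.2 (goodTargets_subset_shadowAt hG (mem_thinMembers.1 hB).1 hz),
      Finset.sum_const, nsmul_eq_mul]
    have hpos : (0 : ℚ) < ((gtTargets M q G B z).card : ℚ) := by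
      rw [card_goodTargets]
      exact_mod_cast Finset.card_pos.2 hne
    field_simp
  · simp only [if_neg hne]
    by_cases hne2 : (d2Targets M q G (insert z B)).Nonempty
    · simp only [if_pos hne2]
      rw [← Finset.sum_filter, Finset.filter_mem_eq_inter,
        Finset.inter_eq_right.2 (d2Targets_subset_shadowAt hG (mem_thinMembers.1 hB).1 hz),
        Finset.sum_const, nsmul_eq_mul]
      have hpos : (0 : ℚ) < ((d2Targets M q G (insert z B)).card : ℚ) := by
        exact_mod_cast Finset.card_pos.2 hne2
      field_simp
    · simp only [if_neg hne2]
      exact dshMissed_row hG hd hB hz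

open scoped Classical in
/-- **The local form from the hybrid rule with the good-target shares and the distance-2 fallback.** -/
theorem localShadowHall_of_gt2 {P : Finset α → Prop} [DecidablePred P] (hG : G ∈ flatsQ M (q + 1))
    (hd : (gr M \ G).card ≤ q)
    (hdl : ∀ S ∈ shadowAt M (q + 2) q (Uq M (q + 2) q) G,
      dload M q G P (dshGT2 M q G) S ≤ cap2 M q G S)
    (hcond : ∀ B ∈ thinMembers M q G, ¬ P B → ∀ z ∈ G \ clF M B,
      loss M q G B z ≤ rhoL M q G B z * lossIncomeH M q G P (dshGT2 M q G) B z) :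
    LocalShadowHall M q G :=
  localShadowHall_of_hybrid hG hd (dshGT2_nonneg hG hd) (dshGT2_supp)
    (fun _ hB _ _ hz => dshGT2_row hG hd hB hz) hdl hcond

end GoodTwoLemmas

section D2Coloop

variable {G : Finset α}

/-- **The coloop transfer** with `K ⊆ Q ∖ w` and `rk (Q ∖ w) = 5` in place of thin membership: a coloop `w` of `Q ∖ K`
with `y ∈ cl (Q ∖ w)` is a coloop of `(Q ∪ {y}) ∖ K` (`Q ⊆ G`, `y ∈ G ∖ K`, `y ∉ Q`, `rk (Q ∖ K) = 5`). -/
theorem mem_coloops_insert_of_mem_clF' (hG : G ∈ flatsQ M (5 + 1)) (hk : kColoops M G = 1) {Q : Finset α}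
    (hQG : Q ⊆ G) (hQ5 : rkN M (Q \ coloops M G) = 5) {w : α} (hw : w ∈ coloops M (Q \ coloops M G))
    (hKQ : coloops M G ⊆ Q.erase w) (hr5 : rkN M (Q.erase w) = 5) {y : α} (hy : y ∈ G \ coloops M G)
    (hyQ : y ∉ Q) (hycl : y ∈ clF M (Q.erase w)) : w ∈ coloops M (insert y Q \ coloops M G) := by
  have hGg : G ⊆ gr M := (mem_flatsQ.1 hG).1
  have hyK : y ∉ coloops M G := (Finset.mem_sdiff.1 hy).2
  have hwQK : w ∈ Q \ coloops M G := (mem_coloops.1 hw).1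
  have hS : insert y Q \ coloops M G = insert y (Q \ coloops M G) := Finset.insert_sdiff_of_notMem _ hyK
  rw [hS, mem_coloops]
  refine ⟨Finset.mem_insert_of_mem hwQK, fun hwcl => ?_⟩
  have hcard1 : (coloops M G).card = 1 := by rw [← kColoops_eq_card_coloops (M := M) G]; exact hk
  obtain ⟨e₀, he₀⟩ := Finset.card_eq_one.1 hcard1
  have he₀c : e₀ ∈ coloops M G := by rw [he₀]; exact Finset.mem_singleton_self _
  have he₀G : e₀ ∈ G := (mem_coloops.1 he₀c).1
  have he₀cl : e₀ ∉ clF M (G.erase e₀) := (mem_coloops.1 he₀c).2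
  have he₀Q : e₀ ∈ Q.erase w := hKQ he₀c
  have hface : Q.erase w = insert e₀ ((Q \ coloops M G).erase w) := by
    ext a
    simp only [Finset.mem_erase, Finset.mem_insert, Finset.mem_sdiff, he₀, Finset.mem_singleton]
    constructor
    · rintro ⟨haw, haQ⟩
      by_cases hae : a = e₀
      · exact Or.inl hae
      · exact Or.inr ⟨haw, haQ, hae⟩
    · rintro (rfl | ⟨haw, haQ, -⟩)
      · exact Finset.mem_erase.1 he₀Q
      · exact ⟨haw, haQ⟩
  have hr4 : rkN M ((Q \ coloops M G).erase w) = 4 := by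
    have := rkN_erase_of_mem_coloops (M := M) (Finset.sdiff_subset.trans (hQG.trans hGg)) hw
    omega
  have hsubV : (Q \ coloops M G).erase w ⊆ G.erase e₀ := by
    intro a ha
    rw [Finset.mem_erase, Finset.mem_sdiff] at ha
    rw [Finset.mem_erase]
    exact ⟨fun h => ha.2.2 (h ▸ he₀c), hQG ha.2.1⟩
  have hycl' : y ∈ clF M ((Q \ coloops M G).erase w) := by
    by_contra hyn
    have h1 := rkN_insert_of_notMem_clF (M := M) (hGg (Finset.mem_sdiff.1 hy).1) hyn
    rw [hr4] at h1
    have hyG : y ∈ G.erase e₀ := Finset.mem_erase.2 ⟨fun h => hyK (h ▸ he₀c), (Finset.mem_sdiff.1 hy).1⟩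
    have he₀n : e₀ ∉ clF M (insert y ((Q \ coloops M G).erase w)) :=
      fun h => he₀cl (clF_mono (Finset.insert_subset hyG hsubV) h)
    have h2 := rkN_insert_of_notMem_clF (M := M) (hGg he₀G) he₀n
    rw [h1] at h2
    have h3 : rkN M (insert y (Q.erase w)) ≤ rkN M (Q.erase w) :=
      rkN_insert_le_of_mem_clF (M := M) ((Finset.erase_subset _ _).trans (hQG.trans hGg)) hycl
    have heq : insert e₀ (insert y ((Q \ coloops M G).erase w)) = insert y (Q.erase w) := by
      rw [hface, Finset.insert_comm]
    rw [heq] at h2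
    rw [hr5] at h3
    omega
  have h4 : rkN M (insert y ((Q \ coloops M G).erase w)) ≤ 4 := by
    have := rkN_insert_le_of_mem_clF (M := M) ((Finset.erase_subset _ _).trans
      (Finset.sdiff_subset.trans (hQG.trans hGg))) hycl'
    omega
  have heq2 : (insert y (Q \ coloops M G)).erase w = insert y ((Q \ coloops M G).erase w) := by
    rw [Finset.erase_insert_of_ne (by rintro rfl; exact hyQ (Finset.mem_sdiff.1 hwQK).1)]
  rw [heq2] at hwcl
  have h5 := rkN_insert_le_of_mem_clF (M := M) (Finset.insert_subset (hGg (Finset.mem_sdiff.1 hy).1)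
    ((Finset.erase_subset _ _).trans (Finset.sdiff_subset.trans (hQG.trans hGg)))) hwcl
  have hins : insert w (insert y ((Q \ coloops M G).erase w)) = insert y (Q \ coloops M G) := by
    rw [Finset.insert_comm, Finset.insert_erase hwQK]
  rw [hins] at h5
  have h6 : 5 ≤ rkN M (insert y (Q \ coloops M G)) := by
    rw [← hQ5]; exact rkN_mono (Finset.subset_insert _ _)
  omega

open scoped Classical in
/-- **A DISTANCE-2 FALLBACK TARGET HAS A COLOOP OFF `K`** (cell `(2, 1)`): for a lossy big pair `(B, z)` whose covering
set `Q` has no good point, every `S ∈ d2Targets Q` has a coloop in `S ∖ K` — the coloop of the third face, whose closure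
contains both added points. -/
theorem exists_mem_coloops_of_d2Target (hG : G ∈ flatsQ M (5 + 1)) (hd : (gr M \ G).card = 2)
    (hk : kColoops M G = 1) (hs : ∀ e ∈ gr M, ∀ f ∈ gr M, e ≠ f → rkN M {e, f} = 2)
    (hl : ∀ e ∈ gr M, M.Indep {e}) {B : Finset α} (hB : B ∈ thinMembers M 5 G)
    (hbig : 5 ≤ (B \ coloops M G).card) {z : α} (hz : z ∈ G \ clF M B) (hl0 : loss M 5 G B z ≠ 0)
    (hno : ¬ (gtPts M 5 G (insert z B)).Nonempty) {S : Finset α} (hS : S ∈ d2Targets M 5 G (insert z B)) :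
    ∃ w, w ∈ coloops M (S \ coloops M G) := by
  have hd' : (gr M \ G).card ≤ 5 := by omega
  obtain ⟨hC3, hImg, -, -⟩ := three_thin_faces_of_loss_ne_zero hG hd hk hs hl hB hbig hz hl0
  set Q := insert z B with hQ
  have hB' : B ∈ membersIn M (Uq M (5 + 2) 5) G := (mem_thinMembers.1 hB).1
  have hBU : B ∈ Uq M (5 + 2) 5 := (mem_membersIn.1 hB').1
  have hBG : B ⊆ G := (subset_clF hBU).trans (mem_membersIn.1 hB').2
  have hQG : Q ⊆ G := Finset.insert_subset (Finset.mem_sdiff.1 hz).1 hBG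
  have hQ5 : rkN M (Q \ coloops M G) = 5 := rkN_insert_sdiff_coloops_eq_five_of_thin hG hd hk hB hz
  have hKB : coloops M G ⊆ B := coloops_subset_of_mem_thinMembers hG hd' hB
  have hGg : G ⊆ gr M := (mem_flatsQ.1 hG).1
  obtain ⟨p, hp, rfl⟩ := mem_d2Targets.1 hS
  obtain ⟨⟨hx, hx'⟩, hxx', F, hF, F', hF', hFF', hxF, hx'F'⟩ := mem_d2Pts.1 hp
  set x := p.1; set x' := p.2
  -- the faces are at coloops `w₁ ≠ w₂` of `Q ∖ K`
  unfold thinFacesOf at hF hF'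
  rw [hImg, Finset.mem_image] at hF hF'
  obtain ⟨w₁, hw₁, rfl⟩ := hF
  obtain ⟨w₂, hw₂, rfl⟩ := hF'
  have hw12 : w₁ ≠ w₂ := fun h => hFF' (by rw [h])
  -- the third coloop `w₃`
  have hC : coloops M (Q \ coloops M G) = {w₁, w₂} ∪ ((coloops M (Q \ coloops M G)) \ {w₁, w₂}) := by
    rw [Finset.union_sdiff_of_subset]
    intro a ha
    rw [Finset.mem_insert, Finset.mem_singleton] at ha
    rcases ha with rfl | rfl
    · exact hw₁
    · exact hw₂
  have hcard : ((coloops M (Q \ coloops M G)) \ {w₁, w₂}).card = 1 := by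
    have h1 := Finset.card_sdiff_add_card_eq_card (show ({w₁, w₂} : Finset α) ⊆ coloops M (Q \ coloops M G) by
      intro a ha
      rw [Finset.mem_insert, Finset.mem_singleton] at ha
      rcases ha with rfl | rfl
      · exact hw₁
      · exact hw₂)
    rw [Finset.card_pair hw12, hC3] at h1
    omega
  obtain ⟨w₃, hw₃⟩ := Finset.card_eq_one.1 hcard
  have hw₃c : w₃ ∈ coloops M (Q \ coloops M G) := by
    have : w₃ ∈ (coloops M (Q \ coloops M G)) \ {w₁, w₂} := by rw [hw₃]; exact Finset.mem_singleton_self _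
    exact (Finset.mem_sdiff.1 this).1
  have hw₃ne : w₃ ≠ w₁ ∧ w₃ ≠ w₂ := by
    have : w₃ ∈ (coloops M (Q \ coloops M G)) \ {w₁, w₂} := by rw [hw₃]; exact Finset.mem_singleton_self _
    have h := (Finset.mem_sdiff.1 this).2
    rw [Finset.mem_insert, Finset.mem_singleton] at h
    push Not at h
    exact h
  -- no good point: a point outside `Q` lies in the closures of at least two faces
  have htwo : ∀ y ∈ G \ Q, ¬ (((coloops M (Q \ coloops M G)).image (fun w => Q.erase w)).filter
      (fun F => y ∈ clF M F)).card ≤ 1 := by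
    intro y hy h1
    apply hno
    refine ⟨y, mem_goodPts.2 ⟨hy, ?_⟩⟩
    unfold thinFacesOf
    rw [hImg]
    exact h1
  -- hence `x ∈ cl (Q ∖ w₃)` and `x′ ∈ cl (Q ∖ w₃)`
  have hkey : ∀ y ∈ G \ Q, ∀ w ∈ coloops M (Q \ coloops M G), y ∉ clF M (Q.erase w) →
      ∀ w' ∈ coloops M (Q \ coloops M G), w' ≠ w → y ∈ clF M (Q.erase w') := by
    intro y hy w hw hyw w' hw' hne
    by_contra hyn
    apply htwo y hy
    -- the faces containing `y` are among the faces at the coloops other than `w, w′`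
    have hsub : ((coloops M (Q \ coloops M G)).image (fun w => Q.erase w)).filter (fun F => y ∈ clF M F) ⊆
        ((coloops M (Q \ coloops M G)) \ {w, w'}).image (fun w => Q.erase w) := by
      intro F hF
      rw [Finset.mem_filter, Finset.mem_image] at hF
      obtain ⟨⟨u, hu, rfl⟩, hyu⟩ := hF
      rw [Finset.mem_image]
      refine ⟨u, Finset.mem_sdiff.2 ⟨hu, ?_⟩, rfl⟩
      rw [Finset.mem_insert, Finset.mem_singleton]
      rintro (rfl | rfl)
      · exact hyw hyu
      · exact hyn hyu
    have hc2 : ((coloops M (Q \ coloops M G)) \ {w, w'}).card = 1 := by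
      have h1 := Finset.card_sdiff_add_card_eq_card (show ({w, w'} : Finset α) ⊆ coloops M (Q \ coloops M G) by
        intro a ha
        rw [Finset.mem_insert, Finset.mem_singleton] at ha
        rcases ha with rfl | rfl
        · exact hw
        · exact hw')
      rw [Finset.card_pair hne.symm, hC3] at h1
      omega
    exact (Finset.card_le_card hsub).trans (Finset.card_image_le.trans (by rw [hc2]))
  have hx3 : x ∈ clF M (Q.erase w₃) := hkey x hx w₁ hw₁ hxF w₃ hw₃c hw₃ne.1
  have hx'3 : x' ∈ clF M (Q.erase w₃) := hkey x' hx' w₂ hw₂ hx'F' w₃ hw₃c hw₃ne.2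
  -- the face `Q ∖ w₃` is a thin member
  have hthin3 : Q.erase w₃ ∈ thinMembers M 5 G := by
    have : Q.erase w₃ ∈ (coverPreimages M (Uq M (5 + 2) 5) G Q).filter (fun F => F ∉ lay0 M 5 G) := by
      rw [hImg, Finset.mem_image]; exact ⟨w₃, hw₃c, rfl⟩
    rw [Finset.mem_filter, mem_coverPreimages] at this
    exact mem_thinMembers.2 ⟨this.1.1, this.2⟩
  have hKQ3 : coloops M G ⊆ Q.erase w₃ := coloops_subset_of_mem_thinMembers hG hd' hthin3
  have hr53 : rkN M (Q.erase w₃) = 5 := rkN_eq_five_of_mem_thinMembers hthin3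
  have hxK : x ∈ G \ coloops M G := by
    refine Finset.mem_sdiff.2 ⟨(Finset.mem_sdiff.1 hx).1, fun h => (Finset.mem_sdiff.1 hx).2 ?_⟩
    exact Finset.mem_insert_of_mem (hKB h)
  have hx'K : x' ∈ G \ coloops M G := by
    refine Finset.mem_sdiff.2 ⟨(Finset.mem_sdiff.1 hx').1, fun h => (Finset.mem_sdiff.1 hx').2 ?_⟩
    exact Finset.mem_insert_of_mem (hKB h)
  -- first step: `w₃` is a coloop of `(insert x′ Q) ∖ K`
  have hstep1 := mem_coloops_insert_of_mem_clF' hG hk hQG hQ5 hw₃c hKQ3 hr53 hx'K (Finset.mem_sdiff.1 hx').2 hx'3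
  -- second step for `Q₁ = insert x′ Q`
  set Q₁ := insert x' Q with hQ₁
  have hQ₁G : Q₁ ⊆ G := Finset.insert_subset (Finset.mem_sdiff.1 hx').1 hQG
  have hQ₁5 : rkN M (Q₁ \ coloops M G) = 5 := by
    have h1 : rkN M (Q \ coloops M G) ≤ rkN M (Q₁ \ coloops M G) :=
      rkN_mono (Finset.sdiff_subset_sdiff (Finset.subset_insert _ _) (Finset.Subset.refl _))
    have h2 : rkN M (Q₁ \ coloops M G) ≤ rkN M (G \ coloops M G) :=
      rkN_mono (Finset.sdiff_subset_sdiff hQ₁G (Finset.Subset.refl _))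
    rw [rkN_sdiff_coloops_eq_five hG hk] at h2
    omega
  have hw₃x' : w₃ ≠ x' := by
    rintro rfl
    exact (Finset.mem_sdiff.1 hx').2 (Finset.mem_sdiff.1 (mem_coloops.1 hw₃c).1).1
  have hQ₁e : Q₁.erase w₃ = insert x' (Q.erase w₃) := by
    rw [hQ₁, Finset.erase_insert_of_ne hw₃x'.symm]
  have hKQ₁ : coloops M G ⊆ Q₁.erase w₃ := by
    rw [hQ₁e]; exact hKQ3.trans (Finset.subset_insert _ _)
  have hr5₁ : rkN M (Q₁.erase w₃) = 5 := by
    rw [hQ₁e]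
    have h1 := rkN_insert_le_of_mem_clF (M := M) ((Finset.erase_subset _ _).trans (hQG.trans hGg)) hx'3
    have h2 : rkN M (Q.erase w₃) ≤ rkN M (insert x' (Q.erase w₃)) := rkN_mono (Finset.subset_insert _ _)
    omega
  have hx3' : x ∈ clF M (Q₁.erase w₃) := by
    rw [hQ₁e]; exact clF_mono (Finset.subset_insert _ _) hx3
  have hxQ₁ : x ∉ Q₁ := by
    rw [hQ₁, Finset.mem_insert, not_or]
    exact ⟨hxx', (Finset.mem_sdiff.1 hx).2⟩
  exact ⟨w₃, mem_coloops_insert_of_mem_clF' hG hk hQ₁G hQ₁5 hstep1 hKQ₁ hr5₁ hxK hxQ₁ hx3'⟩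

end D2Coloop

end PercRepro.Shadow
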